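import Summits.QuantumFields.YangMills.Theorems.SoftKernelBoostCovariance.Negative.TieLoadBearing
import Summits.QuantumFields.YangMills.Theorems.SoftKernelBoostCovariance.Negative.IndexLockingNotDiagRP
import Literature.MathematicalPhysics.QuantumFieldTheory.OSReconstructionNoE1
import Literature.MathematicalPhysics.QuantumFieldTheory.OSLorentzInvariance

/-!
# Disproof of `SoftKernelBoostCovariance` (crux `stmt-QuantumFields-14999`, B′) — findings

Standing adversary (cdisprove, cycle 1, 2026-08-16) on THE ENGINE BELOW DIMENSION FIVE of route
MirrorModularBoosts: `W₁ r sch S₁ → EightFrameRP S₁ → PlanarCone S₁ → SoftKernel S₁ → PlanarInvariant S₁` for every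
compact simple `G` (B′ = the parent B = `CurvatureBoostCovariance`, stmt-9663, with the conclusion of
`CurvatureKernelBound` as one extra hypothesis).  VERDICT SO FAR: **no kill; B′ is unfalsifiable short of an
anisotropic gapped Wilson continuum limit of `tr F²`** (as B: the tie pins `S₁|⁰𝒮`), its MODEL-BLIND core is FALSE
IN LEAN (junk), and the natural strengthening is false.  Everything below is checked Lean (rc 0); the only
`sorry`-free-ness exception is NONE — near-misses are docstring theorems `… : True`.  Prose lives in docstrings.
The parent's work file `Cruxes/CurvatureBoostCovariance/Disproof.lean` (§2 tie pinning, §6 the `β ≡ 0` collapse,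
§5 regimes) applies VERBATIM to B′ (`softKernelBoostCovariance_of_parent`) and is not repeated.

## Index
* §0 `SoftKernel`, `softKernelBoostCovariance_iff` (definitional unbundling), `softKernelBoostCovariance_of_parent`
  (B ⇒ B′).
* §1 LOAD-BEARING ANALYSIS (theorems).  H = the lattice TIE: `softKernelBoostCovariance_false_without_tie`,
  and sharper `…_false_without_tieAt4` (tie kept at every order `≠ 4`, BOTH gaps, the eight frames, the cone and
  the soft kernel kept): witness = the junk family of `NPointIsotropy/Negative` over `SU(2)`, zero scheme, with the
  NEW `planarCone_junk`.  Corollaries `not_softKernelModelBlind` and `not_modelBlind` — the PARENT's near-miss §1b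
  (`curvatureBoostCovariance_false_without_hconv`, the one `sorry` of the parent file) is now a theorem.
  H = SoftKernel: dropping it gives back B, not Lean-refutable (tie); on paper B's model-blind core dies by the
  Gaussian zoo `(1+εe₂(p_μ²)²)/(p²+m²)` which the soft kernel excludes (kernel `ε h₈(x̂)|x|⁻¹⁰`, planner).
  H = cone / diagonal frames / gaps / hypercubic: junk passes them all, so every model-blind drop is refuted by the
  same witness; WITH the tie no drop is refutable (parent §2, §6).
* §2 NON-VACUITY `hypotheses_vac_soft` (every `G`, `r`: zero scheme + vacuum meet `W₁ ∧ 8RP ∧ cone ∧ SoftKernel`).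
* §3 STRENGTHENING REFUTED `not_softKernelBoostCovarianceOnAllTests` (conclusion on all of `𝓢`: `S♯`, half-turn).
* §4 TIGHTNESS of the threshold `|x|⁻¹⁰` / `μ < 4` (docstring theorem `threshold_tight`): `Σ_μ ∂_μ⁴φ` (Δ = 5,
  kernel `∝ h₈(x̂)|x|⁻¹⁰`, `η = 0`) is 16-RP, coned, anisotropic — the exponent cannot be relaxed to `η ≥ 0`.
* §5 LINE `Sketch` (transverse-slack-heat-sandwich): `fieldVec_junk_eq_zero` (every OS field vector of positive
  degree of junk is `0`), whence junk satisfies the CONCLUSIONS of the model-blind stubs 4a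
  (`uniformPlanarBoostVectors_junk`), (T) (`levelStep_conclusion_junk`) and the sandwich bound (Σ) with `μ = 0`,
  `C = 0` (`sandwichBound_junk`, over a verbatim copy `SandwichBound` of `Sketch.PlanarSandwichBound`): the tie enters
  the line ONLY through `stub_tieRegularity` (junk is not `NPointRegular`) and `stub_sandwichBound`; no stub is
  false on junk; (T) resists the Wick/GFF class (docstring theorem `line_assessment`: dimension count Δ ≥ 5 for an
  anisotropic `W(B₄)`-scalar, and internal-index locking `Σ_μ :(∂_μφ_μ)²:` FAILS diagonal RP at the two-point level —
  explicit negative momentum weight).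
* §6 `regimes_tried` — the attack ledger and WHY IT RESISTS.

LANDED (importable; namespace `Summit.QuantumFields.YangMills.Theorems.SoftKernelBoostCovariance.Negative`):
p98735 ACCEPTED `Theorems/SoftKernelBoostCovariance/Negative/TieLoadBearing.lean` (§0–§3: `SoftKernel`,
`softKernelBoostCovariance_iff`, `planarCone_junk`, `not_softKernelBoostCovarianceWithoutTieAt4`, `…WithoutTie`,
`not_softKernelModelBlind`, `not_modelBlind`, `not_softKernelBoostCovarianceOnAllTests`, `hypotheses_vac_soft`) — THIS FILE
IMPORTS IT and only records aliases under the `_false_without_` names; p100982 ACCEPTED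
`Theorems/SoftKernelBoostCovariance/Negative/IndexLockingNotDiagRP.lean` (§5 (iii): `lockKernel_not_diagRP`, the explicit
three-point certificate that the index-locked kernel violates `hdiag`; re-exported below as `indexLocking_not_diagRP`).
-/

noncomputable section

-- tree-known file-local workaround (as in the landed `Negative/*.lean` files and the line skeleton)
attribute [-instance] SimplexCategory.instFintypeToTypeOrderHomFinHAddNatLenOfNat

namespace Summit.QuantumFields.YangMills.Cruxes.SoftKernelBoostCovariance.Disproof

open scoped BigOperators SchwartzMap ComplexConjugate InnerProductSpace
open MeasureTheory Filter Topology Complex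
open Literature.MathematicalPhysics.QuantumLattice Literature.MathematicalPhysics.AQFT
  Literature.MathematicalPhysics.QuantumFieldTheory
open Summit.QuantumFields.YangMills.Theorems.NPointIsotropy.Negative
open Summit.QuantumFields.YangMills.Theorems.CurvatureBoostCovariance.Negative
  (OSPackage Translations Hypercubic EightFrameRP PlanarCone PlanarInvariant PlanarInvariantOnAllTests Tie Gaps W1
    ModelBlind crux_iff vac hypotheses_vac)
open Summit.QuantumFields.YangMills.Theorems.SoftKernelBoostCovariance.Negative

/-! ## §0 The crux unbundled (LANDED: `SoftKernel`, `softKernelBoostCovariance_iff`, `softKernel_vac/sharp/junk`) -/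

/-- **§0b. B ⇒ B′** (one hypothesis more).  CONSEQUENCE: every finding of the parent's Disproof.lean about WHAT A
COUNTEREXAMPLE MUST BE applies verbatim — the tie pins `S₁` on off-diagonal real tensors (`Negative.Unbundled.tie_unique`),
those are dense in `⁰𝒮`, every `c ≡ 0` / `β ≡ 0` scheme collapses to a c-number field (`Negative.BetaZeroTie`), so a
counterexample to B′ is a genuine anisotropic gapped Wilson limit of `tr F²` WITH a soft two-point kernel.  (Not landed:
a positive implication between two route items is a prover's glue, cf. the landed `KernelBoundEngineGlue`.) -/
theorem softKernelBoostCovariance_of_parent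
    (h : Summit.QuantumFields.YangMills.Theses.MirrorModularBoosts.CurvatureBoostCovariance) :
    Summit.QuantumFields.YangMills.Theses.MirrorModularBoosts.SoftKernelBoostCovariance := by
  rw [softKernelBoostCovariance_iff]
  rw [crux_iff] at h
  intro G _ _ _ _ hG r sch S₁ hW h8 hC _
  exact h G hG r sch S₁ hW h8 hC

/-! ## §1 Load-bearing analysis: the TIE (at order 4) is the load-bearing hypothesis (LANDED p98735) -/

/-- **§1a. `softKernelBoostCovariance_false_without_tieAt4`** ("any proof must use the tie AT ORDER 4"): the crux with the
Wilson-convergence clause dropped at `n = 4` only — tie at orders `≠ 4`, OS package, translations, hypercubic, continuum AND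
lattice gap, eight frames, cone, soft kernel all kept — is FALSE: `G = SU(2)`, fundamental representation, zero scheme,
`S₁ = junk` (with the landed `planarCone_junk`, `softKernel_junk`); `𝔖₄(R₀·F₀) = 0 ≠ 𝔖₄(F₀)`. -/
theorem softKernelBoostCovariance_false_without_tieAt4 : ¬ SoftKernelBoostCovarianceWithoutTieAt4 :=
  not_softKernelBoostCovarianceWithoutTieAt4

/-- **§1b. `softKernelBoostCovariance_false_without_tie`** (the whole tie; the lattice gap does not rescue it). -/
theorem softKernelBoostCovariance_false_without_tie : ¬ SoftKernelBoostCovarianceWithoutTie :=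
  not_softKernelBoostCovarianceWithoutTie

/-- **§1c. The model-blind core of B′ is false** (junk: E0, E0h, E0', E2, E3, E4, translations, hypercubic, gap 1,
eight-frame RP, planar cone, soft kernel `K = 0`, `𝔖₄` not planar invariant). -/
theorem softKernelBoostCovariance_false_without_lattice : ¬ SoftKernelModelBlind :=
  not_softKernelModelBlind

/-- **§1d. THE PARENT's NEAR-MISS CLOSED: `¬ ModelBlind`** for `CurvatureBoostCovariance` (stmt-9663), the one `sorry` of
`Cruxes/CurvatureBoostCovariance/Disproof.lean` (§1b there, paper witness the Gaussian zoo); Lean witness: junk.  So the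
intended modular proof (Borchers / BGL / BDFS), being model-blind, cannot prove B either. -/
theorem curvatureBoostCovariance_false_without_tie : ¬ ModelBlind :=
  not_modelBlind

/-- **§1e. NOT refutable drops (information for provers).**  `SoftKernelBoostCovarianceWithoutLatticeGap` (landed def,
glued to the crux by `softKernelBoostCovariance_of_withoutLatticeGap`): `HasLatticeMassGap` enters no stub of the picked
line and no refutation — possibly unnecessary.  Dropping `SoftKernel` gives the parent B (tie-protected alike).  Dropping
the cone, the diagonal frames, E4 or the continuum gap: with the tie kept nothing is refutable (parent §2, §6); without
the tie each drop is already refuted by junk (§1c is stronger). -/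
theorem drops_assessed : True := trivial

/-! ## §2 Non-vacuity (LANDED: `hypotheses_vac_soft` — every `G`, `r`: zero scheme + vacuum meet `W₁ ∧ 8RP ∧ cone ∧
SoftKernel ∧ conclusion`; `W₁` carries no non-triviality) -/

/-! ## §3 The natural strengthening (conclusion on all of `𝓢`) is false (LANDED: `not_softKernelBoostCovarianceOnAllTests`,
witness `S♯` = vacuum + evaluation at `(e₁,e₁,e₁)` in degree 3, `K = 0`, half-turn; never state invariance on `𝓢`) -/

/-! ## §4 Tightness of the threshold -/

/-- **§4. TIGHTNESS OF THE THRESHOLD (paper; nothing to land).**  The soft-kernel exponent `η > 0` (two-point UV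
degree `< 10`, "dimension `< 5`") and the sandwich exponent `μ < 4` of the line cannot be relaxed to `η ≥ 0` /
`μ ≤ 4`: the Gaussian species `s = Σ_μ ∂_μ⁴φ` (φ the free massive scalar) is a `W(B₄)`-scalar, RP in all 16 mirror
frames (even under every reflection, a field of an `O(4)`-covariant RP theory), gapped, coned, with two-point
kernel `(Σ_μ∂_μ⁴)² G_m = c·h₈(x̂)|x|⁻¹⁰ + (radial) + O(|x|⁻⁸ log)` — `h₈` the non-zero harmonic `W(B₄)`-invariant
octic of the planner's zoo computation (`h₈(e₀) = 235008`) — i.e. `|K| ≍ |x|⁻¹⁰` exactly (`η = 0`), and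
`⟨ss⟩` is NOT rotation invariant.  Equivalently the zoo witness `(1+εe₂(p_μ²)²)/(p²+m²)` of the parent.  In any
unitary theory with a scale-invariant UV limit an anisotropic `W(B₄)`-scalar has a spin-4 component, whose
dimension is `≥ 5` (descendant `∂⁴φ`, `Δ_φ ≥ 1`) or `≥ 6` (spin-4 primary, unitarity bound `ℓ + 2`), with equality
`Δ = 5` only for `∂_μ∂_ν∂_ρ∂_σ φ`, `φ` FREE massless: the threshold sits exactly at the first Gaussian objection. -/
theorem threshold_tight : True := trivial

/-! ## §5 Line `Sketch` (transverse-slack-heat-sandwich): the stubs on the junk family -/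

/-- **Every OS field vector of positive degree of the junk family is `0`**: `‖Ψ_F‖² = 𝔖_{2n}(θF* ⊗ F) = 0`
(`junk_append_eq_zero`).  Hence every MODEL-BLIND statement of the line that speaks of `h.fieldVec` norms or of
holomorphic families of such vectors holds for junk with `V ≡ 0`. -/
theorem fieldVec_junk_eq_zero (h : OSReconstructionNoE1 junk.toLabelled) {n : ℕ} (hn : n ≠ 0)
    (k : Fin n → Unit) (F : 𝓢((Fin n → E4), ℂ)) (hF : IsTimeOrdered F) : h.fieldVec n k F hF = 0 := by
  rw [← inner_self_eq_zero (𝕜 := ℂ),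
    h.inner_fieldVec_fieldVec k k hF hF (isAppendTensorOf_appendTensor (osAdjoint F) F)]
  show junk (n + n) ((osAdjoint F).appendTensor F) = 0
  exact junk_append_eq_zero (by omega) (timeSep_of_isTimeOrdered hF) (timeSep_of_isTimeOrdered hF)
    (isAppendTensorOf_appendTensor (osAdjoint F) F)

/-- The junk family admits the `e₀`-reconstruction (E2 + translations). -/
theorem osReconstruction_junk : OSReconstructionNoE1 junk.toLabelled :=
  ⟨junk_rp, fun n _ a F _ => junk_translate n a F⟩

/-- **Stub 4a's CONCLUSION holds for junk** (every degree, type `N = 0`, `V` constant): in degree `0` the rotated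
test function equals the original, in positive degree every field vector is `0`.  So 4a cannot be refuted by junk,
and — being model-blind — sees nothing of junk's anisotropy. -/
theorem uniformPlanarBoostVectors_junk (h : OSReconstructionNoE1 junk.toLabelled) (n : ℕ) :
    ∃ N : ℝ, ∀ (F : SchwartzMap (Fin n → E4) ℂ), IsTimeOrdered F →
      HasCompactSupport (F : (Fin n → E4) → ℂ) →
      ∃ ε : ℝ, 0 < ε ∧ ∃ (V : ℂ → h.Hilbert) (C : ℝ),
        DifferentiableOn ℂ V {θ : ℂ | |θ.re| < ε} ∧
        (∀ θ : ℂ, |θ.re| < ε → ‖V θ‖ ≤ C * Real.exp (N * |θ.im|)) ∧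
        ∀ θ : ℝ, |θ| < ε → ∀ hθ : IsTimeOrdered (linActMulti (planeRot (0 : Fin 3) θ) F),
          V θ = h.fieldVec n (fun _ => ()) (linActMulti (planeRot (0 : Fin 3) θ) F) hθ := by
  refine ⟨0, fun F hF _ => ⟨1, one_pos, ?_⟩⟩
  rcases Nat.eq_zero_or_pos n with rfl | hn
  · refine ⟨fun _ => h.fieldVec 0 (fun _ => ()) F hF, ‖h.fieldVec 0 (fun _ => ()) F hF‖,
      differentiableOn_const _, fun θ _ => by simp, fun θ _ hθ => ?_⟩
    have hEq : linActMulti (planeRot (0 : Fin 3) θ) F = F := by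
      ext x
      rw [linActMulti_apply]
      congr 1
      funext i
      exact Fin.elim0 i
    show h.fieldVec 0 (fun _ => ()) F hF = h.fieldVec 0 (fun _ => ()) (linActMulti (planeRot (0 : Fin 3) θ) F) hθ
    rw [h.fieldVec_eq_genVec, h.fieldVec_eq_genVec]
    exact congrArg h.genVec (OSReconstructionNoE1.Gen.mk_eq ⟨0, fun _ => (), F, hF⟩ hθ hEq).symm
  · refine ⟨fun _ => 0, 0, differentiableOn_const _, fun θ _ => by simp, fun θ _ hθ => ?_⟩
    rw [fieldVec_junk_eq_zero h hn.ne']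

/-- **Stub (T)'s CONCLUSION holds for junk** at every level `a ≠ 0` (type `N' = 0 < 4`, `V ≡ 0`): the model-blind
level step cannot be refuted by junk either. -/
theorem levelStep_conclusion_junk (h : OSReconstructionNoE1 junk.toLabelled) {a : ℕ} (ha : a ≠ 0)
    (F : SchwartzMap (Fin a → E4) ℂ) (hF : IsTimeOrdered F) :
    ∃ ε : ℝ, 0 < ε ∧ ∃ (V : ℂ → h.Hilbert) (C' N' : ℝ), N' < 4 ∧
      DifferentiableOn ℂ V {θ : ℂ | |θ.re| < ε} ∧
      (∀ θ : ℂ, |θ.re| < ε → ‖V θ‖ ≤ C' * Real.exp (N' * |θ.im|)) ∧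
      ∀ θ : ℝ, |θ| < ε → ∀ hθ : IsTimeOrdered (linActMulti (planeRot (0 : Fin 3) θ) F),
        V θ = h.fieldVec a (fun _ => ()) (linActMulti (planeRot (0 : Fin 3) θ) F) hθ := by
  have _ := hF
  refine ⟨1, one_pos, fun _ => 0, 0, 0, by norm_num, differentiableOn_const _, fun θ _ => by simp,
    fun θ _ hθ => ?_⟩
  rw [fieldVec_junk_eq_zero h ha]

/-- **Verbatim copy of the line's `Sketch.PlanarSandwichBound`** (the Cruxes line file is not importable here). -/
def SandwichBound (S₁ : SchwingerFamily E4) (h : OSReconstructionNoE1 S₁.toLabelled) (μ C : ℝ) : Prop :=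
  ∀ (u v : ℝ), 0 < u → 0 < v → u ≤ 1 → v ≤ 1 →
  ∀ (f₁ : 𝓢((Fin 1 → E4), ℂ)) (g hh : ℝ × ℝ → ℂ) (Mg Mh Mh' : ℝ),
    (∀ x : Fin 1 → E4, f₁ x = g (x 0 0, x 0 1) * hh (x 0 2, x 0 3)) →
    (∀ p : ℝ × ℝ, g p ≠ 0 → u ≤ p.1 ∧ p.1 ≤ 2 * u) →
    MeasureTheory.Integrable g → (∫ p, ‖g p‖) ≤ Mg →
    MeasureTheory.Integrable hh → (∫ p, ‖hh p‖) ≤ Mh → (∀ p, ‖hh p‖ ≤ Mh') →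
  ∀ (n : ℕ) (W : 𝓢((Fin n → E4), ℂ)) (hW : IsTimeOrdered W)
    (hFW : IsTimeOrdered
      (SchwartzMap.appendTensor f₁ (translateMulti ((2 * u + v) • EuclideanSpace.single 0 1) W))),
    ‖h.fieldVec (1 + n) (fun _ => ())
        (SchwartzMap.appendTensor f₁ (translateMulti ((2 * u + v) • EuclideanSpace.single 0 1) W)) hFW‖
      ≤ C * Mg * (Mh + Mh') * (u ^ (-μ) + v ^ (-μ)) * ‖h.fieldVec n (fun _ => ()) W hW‖

/-- **Stub (Σ)'s CONCLUSION holds for junk** with `μ = 0 < 4`, `C = 0`: the left-hand side is the norm of a field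
vector of degree `1 + n ≥ 1`, which is `0`.  So (Σ) — whose hypotheses carry the tie — is at least consistent with
every certified inhabitant AND with junk; the tie it consumes is not what excludes junk from the line (Step 0 is). -/
theorem sandwichBound_junk (h : OSReconstructionNoE1 junk.toLabelled) :
    ∃ μ C : ℝ, μ < 4 ∧ SandwichBound junk h μ C := by
  refine ⟨0, 0, by norm_num, ?_⟩
  intro u v _ _ _ _ f₁ g hh Mg Mh Mh' _ _ _ _ _ _ _ n W hW hFW
  rw [fieldVec_junk_eq_zero h (by omega)]
  simp

/-- **§5 (iii) in Lean (LANDED p100982).**  The two-point kernel `lockKernel = Σ_μ(∂_μ²|x|⁻²)²` of the dimension-4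
index-locked composite `Σ_μ :(∂_μφ_μ)²:` violates diagonal reflection positivity in the matrix form `hdiag` of
`PencilRigidity.ShellRigidity` (witness `(2,0,0,0), (3,1,0,0), (4,2,0,0)`, `c = (1,−1,1)`, value `−45069/32000000`). -/
theorem indexLocking_not_diagRP : ¬ DiagRP lockKernel := lockKernel_not_diagRP

/-- **§5. LINE ASSESSMENT (refuter's pre-assessment of the six registered stubs; paper where not stated above).**
* `stub_tieRegularity` (Step 0; USES THE TIE): its model-blind form is FALSE (junk is not `NPointRegular`,
  `NPointIsotropy.Negative.not_nPointRegular_junk`); with the tie it is a genuine property of the Wilson limit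
  (promote-stub on record).  By §1 above the tie MUST enter somewhere; in this line it enters here and in (Σ).
* `stub_uniformPlanarBoostVectors` (4a; model-blind, XL): holds for junk (`uniformPlanarBoostVectors_junk`, `V`
  constant); plausible in general (planar tube continuation with `H_χ = cosh χ H − sinh χ P₁ ≥ 0` once the cone holds;
  uniformity `∃ N ∀ F` is natural since the contraction bound has no `F`-dependence in the exponent).  Not attackable
  by junk-type witnesses (their OS spaces are vacuum-only).
* `stub_sandwichBound` (Σ; USES THE TIE): `h : OSReconstructionNoE1 _` is a `Prop`, `h.Hilbert` canonical — no junk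
  freedom in `h`.  Holds on every certified inhabitant of `W₁` (vacuum, `c ≡ 0`, `β ≡ 0` c-number fields: `μ = 0`)
  and on junk (`sandwichBound_junk`).  Its vacuum row forces `μ ≥ Δ₂ − 1` for a two-point UV degree `2Δ₂`
  (transversally extended insertions, `Mh ≍ 1`, `Mh' = 1`), so `μ < 4 ⟺ Δ₂ < 5` there: (Σ) is the operator-norm
  upgrade of the soft kernel, refutable only through a Wilson limit.
* `stub_levelStepOfSandwich` (T; model-blind, XL): holds for junk (`levelStep_conclusion_junk`).  A model-blind
  counterexample needs, at level `a = 2`: `𝔖₀,𝔖₁,𝔖₂` planar invariant, 8-frame RP, cone, sandwich `μ < 4`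
  (⇒ `Δ₂ < 5`), and a doubled degree-4 orbit with a layer `|k| ≥ 2`.  OBSTRUCTIONS FOUND: (i) Gaussian/GFF: `𝔖₄`
  is Wick of `𝔖₂`, invariant; (ii) Wick polynomials of scalar (generalised) free fields on which all 16 reflections
  act WITHOUT internal relabelling: an anisotropic `W(B₄)`-scalar needs the rank-4 invariant `Σ_μ e_μ^{⊗4}` contracted
  with four derivative indices ⇒ `Δ ≥ 5` (`Σ∂_μ⁴φ`, Gaussian) / `≥ 6` (non-Gaussian, e.g. `Σ_μ:∂_μ²φ∂_μ²ψ:`) ⇒ `Δ₂ ≥ 5`,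
  excluded by `μ < 4`; (iii) INTERNAL-INDEX LOCKING (i.i.d. scalars `φ_μ`, `W(B₄)` acting by relabelling), e.g.
  `s = Σ_μ :(∂_μφ_μ)²:` of dimension 4: axis-mirror RP holds (each `:(∂_μφ_μ)²:` is reflection-even) but DIAGONAL RP
  FAILS ALREADY FOR `⟨ss⟩ = 2Σ_μ(∂_μ²G)²`: across `x₀ = x₁` (tangential `u`, normal `v`) the reflected two-point
  form has momentum weight `W(q,q') = ½[(ωω' − q_u q_u')² − (q_u ω' + q_u' ω)²] + q₂²q₂'² + q₃²q₃'²` on pairs of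
  on-shell momenta, and `W → −2 q_u² q_u'² < 0` near collinear tangential pairs (`q_⊥, q_⊥' → 0`, threshold
  `ω + ω' ↓ |q_u + q_u'|`), where finite positive-time configurations can concentrate the form — relabelling
  involutions `σ` turn the OS form into `‖F₊‖² − ‖F₋‖²`, never positive on a field algebra.  NUMERICS + EXACT
  CERTIFICATE (folder `rpcheck.py`, `cert.py`, massless `G = |x|⁻²`, `K = Σ_μ(∂_μ²G)² = 16(4Σx_μ⁴ − |x|⁴)/|x|¹²`,
  `W(B₄)`-invariant, continuous off 0, `|K| ≤ 48|x|⁻⁸` so soft with `η = 2`): axis mirror `λ_min/λ_max ≥ −4·10⁻¹¹`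
  over 60 random 10-point configurations (PSD, as the Schur argument predicts); diagonal mirror `x₀ ↔ x₁` on
  tangential chains `λ_min/λ_max = −0.118`; exact rational witness `x = (2,0,0,0), (3,1,0,0), (4,2,0,0)` (all
  `x₀ > x₁`), `c = (1,−1,1)`: `Σ c_i c_j K(ρx_i − x_j) = −45069/32000000 < 0` — the hypothesis `hdiag` of the LANDED
  `ShellRigidity_proof` fails for this kernel (consistently: it is not radial), so the sibling theorem is not
  contradicted and the index-locked composite is not 8-frame RP; (iv) vector / tensor GFF
  building blocks (honest `O(4)` multiplets, RP with the geometric action) carry a dimension-2 UV piece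
  (`p_μp_ν/M²` of every Proca weight) ⇒ `Σ_μ:V_μ⁴:` has `Δ = 8`.  So (T) resists the whole Borchers class below the
  threshold; a counterexample must be a genuinely non-Gaussian, non-`O(4)`-covariant 8-RP coned continuum family
  with `Δ₂ < 5` — none is known (cf. route KILL CRITERIA).  Joint sufficiency: `levelGrowthHigh_of_stubs`,
  `sieve_of_stubs`, `SoftKernelBoostCovariance_of` are sorry-free compositions BY NAME; no gap is smuggled
  (`IsOffDiagonal` kept, §3 honoured).
* `stub_laurentLayers` (L3): served (p96941).  `stub_levelGrowthHigh_of_boostType` (5b′): TRUE model-blind by the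
  pencil identity `Σ p_k e^{−4kχ} = ‖V(iχ)‖² ≤ C'² e^{2N'|χ|}`, `2N' < 8`, (L3) in both directions; degenerate cases
  (`F = 0`, `C' < 0`, `N' < 0`) are harmless. -/
theorem line_assessment : True := trivial

/-! ## §6 Regimes tried; why B′ resists -/

/-- **§6. ATTACK LEDGER (cycle 1).**
* Junk / singular-support families (`𝔖₄ = J` on the exceptional 7-plane orbit): pass EVERY clause about `S₁` alone,
  INCLUDING the planar cone and the soft kernel (§1) — model-blind core dead in Lean; blocked from B′ only by the tie
  (order 4).
* Degenerate schemes (`c ≡ 0`, `β ≡ 0`, any `r`, any `G`): tied families are c-number fields on `⁰𝒮`-tensors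
  (parent §6, landed `Negative.BetaZeroTie`), conclusion HOLDS; small `β` (Osterwalder–Seiler strong coupling):
  correlations decay at lattice rate `m(β₀) ≫ Δ a_k`, every multiplicatively renormalised limit is again a c-number
  field (paper).  Fast `β_k → ∞` (free-gluon limit `c_k = β_k a_k⁻⁴`): non-trivial `O(4)`-INVARIANT Maxwell `F²`
  correlators, but NO gap (`HasLatticeMassGap` fails at `n ≫ (Δa_k)⁻¹`) — excluded by `Gaps`.
* Gaussian zoo `N(p)/(p²+m²)`, `N` shell-positive in 16 frames: excluded by the soft kernel (degree-8 top layer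
  saturates `|x|⁻¹⁰`; planner + refuter g48-5, signed-superposition loophole closed).
* Wick polynomials / internal-index locking / vector GFFs: §5 (iii)–(iv) — either `Δ₂ ≥ 5` or diagonal RP fails.
* Strengthenings: conclusion on all of `𝓢` FALSE (§3); tie dropped at order 4 FALSE (§1); `η ≥ 0` FALSE on paper (§4).
THE WALL (unchanged from the parent): a counterexample to B′ is a subsequential Wilson continuum limit of `tr F²`
strings along `β_k → ∞` with uniform lattice gap, soft two-point kernel and an anisotropic `𝔖ₙ` — control of 4D
non-abelian lattice gauge theory at weak coupling.  Conversely no cheap PROOF exists: the model-blind core is false,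
so the lattice four-point functions themselves must be used (§1a). -/
theorem regimes_tried : True := trivial

end Summit.QuantumFields.YangMills.Cruxes.SoftKernelBoostCovariance.Disproof

end
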